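import Summits.QuantumFields.BalabanUV.T4Continuum.Support.RegionStarLineGauge
import Summits.QuantumFields.BalabanUV.T4Continuum.Support.RegionScalarCompression

/-!
# T⁴ programme, spine node NE2 (U1a), sub-row Δ1 «NE2⁰-Dirichlet» — THE FACE-FLUX COARSE FIELD OF A STAR-BOND FIELD:
# `Φ(B)(y,ν) = n^{1−d}·Σ_{top ν-face of B(y)} B_ν`, the Stokes identity `∂₁ᴴ·Φ = Q′_Ω·∂_Ωᴴ`, and «Φ(B) ⊥ ∂₁(𝒟_S)» for
# region-divergence-free `B`

Row NE2 OWNER item O14-a «Δ1-VEC-W1-BOX» (unit `b2b-balaban-t4-ne2-p1`, gen 14; ruling R30 (c), journal 2026-08-20 l.19379), file 1: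
the coarse comparison field of the TWO-SCALE TRANSVERSE POINCARÉ inequality behind W1 (`RegionGaugeSlice.SliceCoercive`) on boxes.

THE MECHANISM (ours; no printed statement is used).  W1 in ORBIT form (leaf-09-g9 `RegionGaugeOrbit.orthSlice_of_gaugePoincare`) asks, for
every star-bond field `A`, for SOME Dirichlet scalar `μ` with `nsq (A − ∂_Ωμ) ≤ C₁·nsq (curlR A) + C₂·n^d·nsq (avgR A)`.  With `μ` the
COULOMB potential (`∂_Ωᴴ∂_Ωμ = ∂_ΩᴴA`, file 3) the remainder `B = A − ∂_Ωμ` is REGION-DIVERGENCE-FREE, and the mass term must be read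
through `Q B = QA − ∂₁Q′_Ωμ` — i.e. MODULO coarse Dirichlet gradients `∂₁g`, `g` supported on `S`.  The part of `√(n^d)·QB` that no
coarse gradient can cancel is measured against a coarse field that is EXACTLY orthogonal to all of them: the FACE FLUX
`Φ(B)(y,ν) := n^{1−d}·Σ_{z ∈ B(y), digit_ν z = n−1} B(z,ν)` (mean normal component over the top `ν`-face of the block `B(y)`, over ALL
unit bonds `(y,ν)` — for `y ∉ S` the face bonds are the INCOMING star bonds of `B(y+e_ν)` when `y + e_ν ∈ S`, else absent).
 * §1 `faceAvg` and its entries.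
 * §2 **`grad1R_conjTranspose_mul_faceAvg : (grad₁R M S)ᴴ * faceAvg n M S = QOm n M S * (gradR n M S)ᴴ`** — the lattice STOKES
   identity «coarse divergence of the face fluxes of block `y` = `n^{1−d}`·(net flux out of `B(y)`) = `n^{−d}·Σ_{x∈B(y)}` fine
   divergence»: both sides have the entry `n^{1−d}·([blockOf (z+e_ν) = y] − [blockOf z = y])` at `(y, (z,ν))` (a unit step in
   direction `ν` leaves the block iff the `ν`-digit is `n − 1`: leaf-09-g9's `blockOf_add_unitVec_e_of_lt/eq`).
   (Compare the tree's «Q∂ = ∂₁Q′» `RegionGaugeFixedVector.avgR_mul_gradR`: that one intertwines the GRADIENTS through Bałaban's line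
   average `Q`; this one intertwines the DIVERGENCES through the face average — `Q` itself does NOT: `∂₁ᴴ(QB) ≠ Q′(∂ᴴB)`, the
   boundary half-tents of `Q` carry a unit-scale divergence `∓½·(normal flux)` even for `B = e_ν` on a slab.)
 * §3 consequences for `B` with `gradRᴴ B = 0`: **`faceAvg_orth`** `⟨∂₁g, Φ(B)⟩ = 0` for every `g : S → ℂ`, hence
   **`nsq_faceAvg_le_nsq_sub_grad1R`** `nsq Φ(B) ≤ nsq (Φ(B) − ∂₁g)` — the coarse gradients are conceded, the face flux survives.
 * §4 vocabulary for files 2–3: the tent weights `tentW` (`Λ = 1` on unit bonds with both ends in `S`, `λ_n = lamB n = (n+1)/(2n)` otherwise)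
   of the comparison «`√(n^d)·(QB) ≈ Λ•Φ(B)` up to interior `ν`-differences of `B_ν`» (file 2), with **`abs_one_sub_tentW_le`** `|1 − Λ| ≤ ½`.
   TARGET SHAPE of file 2 (the tent-vs-face comparison, for EVERY star-bond field, no hypothesis):
   `(n:ℝ)^d · nsq (fun i => (avgR n M S *ᵥ B) i − (tentW n M S i : ℂ) * (faceAvg n M S *ᵥ B) i) ≤ C♭ · Σ_μ nsq (igrad M S n μ B)`.

HONEST FRAMING (T4-DAG p. 1).  [folklore] finite lattice calculus on the cell's typed `U = 1` objects (`QsOp`, `bpt`, `digits`,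
`starReg`, `gradR`, `grad₁R`, `QOm`); model level (one region = any union of unit blocks, one averaging scale, finite torus); nothing
printed is a hypothesis or a conclusion; W1 itself is NOT proved here (files 2–3); NE2 (U1a) NOT proved; spine PROVED 0/9 unchanged;
NOT [B9] (3.16)/(3.23)–(3.27) as printed; NOT infinite volume / mass gap / Clay.  HONEST DEPENDENCY: continuum YM on T⁴ ⇐ BetaPertH ∧
nine spine estimates (0/9 proved); BetaPertH ⇐ (D1) ∧ (D4) ∧ CAP+tail; G-an2-4 gates asym, D1 and NE2/3/4.  No `sorry`.
-/

noncomputable section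

open scoped BigOperators ComplexConjugate Matrix
open Finset

namespace Summit.QuantumFields.BalabanUV.T4Continuum.RegionFaceFlux

open Literature.MathematicalPhysics.QuantumFieldTheory.Balaban1983to89.B5Prop11Plancherel (Tor fine unitVec)
open Literature.MathematicalPhysics.QuantumFieldTheory.Balaban1983to89.B5Prop11Lower (nsq nsq_nonneg star_dotProduct_self)
open Literature.MathematicalPhysics.QuantumFieldTheory.Balaban1983to89.B5Action121 (GradOp star_mulVec_dotProduct
  dotProduct_mulVec_eq_star_conjTranspose_mulVec)
open Literature.MathematicalPhysics.QuantumFieldTheory.Balaban1983to89.B5Block118 (bpt QsOp)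
open Literature.MathematicalPhysics.QuantumFieldTheory.Balaban1983to89.B5Blocks16 (blockOf blockOf_bpt)
open Summit.QuantumFields.BalabanUV.T4Continuum
open Summit.QuantumFields.BalabanUV.T4Continuum.SubtypeCompression (ext toBlock_conjTranspose toBlock_mul_of_vanish_left)
open Summit.QuantumFields.BalabanUV.T4Continuum.ScalarBlockPoincare (QsOp_apply_blockOf)
open Summit.QuantumFields.BalabanUV.T4Continuum.RegionGaugeFixedVector (starReg gradR grad₁R GradOp_apply)
open Summit.QuantumFields.BalabanUV.T4Continuum.RegionScalarCompression (QOm)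
open Summit.QuantumFields.BalabanUV.T4Continuum.RegionStarLineGauge (edig edig_lt blockOf_add_unitVec_e_of_lt blockOf_add_unitVec_e_of_eq)
open Summit.QuantumFields.BalabanUV.Beta.GAN24.DirichletBoxTrace (blockReg)

variable {d : ℕ} (n : ℕ) [NeZero n] (M : Fin d → ℕ) [hM : ∀ μ, NeZero (M μ)] (S : Tor M → Prop) [DecidablePred S]

/-! ## §1 The face-flux coarse field -/

/-- the normalisation `n^{1−d} = n / n^d` of a face MEAN (a `ν`-face of a block carries `n^{d−1}` bonds). [folklore] -/
def faceW (d n : ℕ) : ℂ := (n : ℂ) / (n : ℂ) ^ d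

/-- **THE FACE-FLUX COARSE FIELD** `Φ(B)(y,ν) = n^{1−d}·Σ_{z ∈ B(y), ν-digit of z = n−1} B(z,ν)`: the mean normal component of `B` over
the top `ν`-face of the block `B(y)`, for EVERY unit bond `(y,ν)` (rows with no star face bond vanish). [folklore] -/
def faceAvg : Matrix (Tor M × Fin d) {b // starReg n M S b} ℂ := fun i b =>
  if b.1.2 = i.2 ∧ blockOf n M b.1.1 = i.1 ∧ edig n M i.2 b.1.1 + 1 = n then faceW d n else 0

/-- the top-face predicate is decided by the `ν`-digit: `edig z + 1 = n` or `edig z + 1 < n`. [folklore] -/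
theorem edig_succ_eq_or_lt (ν : Fin d) (z : Tor (fine n M)) : edig n M ν z + 1 = n ∨ edig n M ν z + 1 < n := by
  have := edig_lt n M ν z; omega

/-! ## §2 The Stokes identity `∂₁ᴴ·Φ = Q′_Ω·∂_Ωᴴ` -/

/-- the entries of `Q′_Ω·∂_Ωᴴ`: `(Q′_Ω ∂_Ωᴴ)(y, (z,ν)) = n^{1−d}·([blockOf (z + e_ν) = y] − [blockOf z = y])`. [folklore] -/
theorem QOm_mul_gradR_conjTranspose_apply (y : {y // S y}) (b : {b // starReg n M S b}) :
    (QOm n M S * (gradR n M S)ᴴ) y b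
      = faceW d n * ((if blockOf n M (b.1.1 + unitVec (fine n M) b.1.2) = y.1 then 1 else 0)
          - (if blockOf n M b.1.1 = y.1 then 1 else 0)) := by
  -- `Q′` never couples the block `y ∈ S` to a site outside `Ω`, so the product over `Ω` is the torus product read on the blocks
  have hX : ∀ (y' : Tor M) (x : Tor (fine n M)), S y' → ¬ blockReg n M S x → QsOp n M y' x = 0 := by
    intro y' x hy hx
    rw [QsOp_apply_blockOf, if_neg]
    intro h; exact hx (show S (blockOf n M x) by rw [h]; exact hy)
  have e1 : QOm n M S * (gradR n M S)ᴴ = (QsOp n M * (GradOp (fine n M) (n : ℂ))ᴴ).toBlock S (starReg n M S) := by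
    unfold QOm gradR
    rw [toBlock_conjTranspose, ← toBlock_mul_of_vanish_left S (blockReg n M S) (starReg n M S) _ _ hX]
  rw [e1, Matrix.toBlock_apply, Matrix.mul_apply]
  have key : ∀ x : Tor (fine n M), QsOp n M y.1 x * (GradOp (fine n M) (n : ℂ))ᴴ x b.1
      = (n : ℂ) * (if x = b.1.1 + unitVec (fine n M) b.1.2 then QsOp n M y.1 x else 0)
        - (n : ℂ) * (if b.1.1 = x then QsOp n M y.1 x else 0) := by
    intro x
    rw [Matrix.conjTranspose_apply, GradOp_apply, star_mul, star_sub, Complex.star_def, map_natCast,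
      apply_ite (starRingEnd ℂ), apply_ite (starRingEnd ℂ), map_one, map_zero]
    split_ifs <;> ring
  rw [Finset.sum_congr rfl fun x _ => key x, Finset.sum_sub_distrib, ← Finset.mul_sum, ← Finset.mul_sum,
    Finset.sum_ite_eq' univ, if_pos (mem_univ _), Finset.sum_ite_eq univ, if_pos (mem_univ _),
    QsOp_apply_blockOf, QsOp_apply_blockOf]
  unfold faceW
  split_ifs <;> ring

omit [DecidablePred S] in
/-- the entries of `∂₁ᴴ·Φ`: `(∂₁ᴴ Φ)(y, (z,ν)) = Φ((y − e_ν, ν), (z,ν)) − Φ((y,ν), (z,ν))`. [folklore] -/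
theorem grad1R_conjTranspose_mul_faceAvg_apply (y : {y // S y}) (b : {b // starReg n M S b}) :
    ((grad₁R M S)ᴴ * faceAvg n M S) y b
      = faceAvg n M S (y.1 - unitVec M b.1.2, b.1.2) b - faceAvg n M S (y.1, b.1.2) b := by
  rw [Matrix.mul_apply, Fintype.sum_prod_type]
  simp only [Matrix.conjTranspose_apply, grad₁R, Matrix.submatrix_apply, id, GradOp_apply, one_mul, star_sub,
    apply_ite (star : ℂ → ℂ), star_one, star_zero]
  -- only the direction `μ = ν` of the bond contributes
  have hμ : ∀ (y' : Tor M) (μ : Fin d), μ ≠ b.1.2 →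
      ((if y.1 = y' + unitVec M μ then (1:ℂ) else 0) - (if y' = y.1 then 1 else 0)) * faceAvg n M S (y', μ) b = 0 := by
    intro y' μ h
    have : faceAvg n M S (y', μ) b = 0 := by
      unfold faceAvg; rw [if_neg]; rintro ⟨h1, -⟩; exact h h1.symm
    rw [this, mul_zero]
  rw [Finset.sum_comm]
  rw [Finset.sum_eq_single b.1.2 (fun μ _ hne => Finset.sum_eq_zero fun y' _ => hμ y' μ hne) (fun h => absurd (mem_univ _) h)]
  simp only [sub_mul, Finset.sum_sub_distrib, ite_mul, one_mul, zero_mul]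
  have t1 : ∑ y' : Tor M, (if y.1 = y' + unitVec M b.1.2 then faceAvg n M S (y', b.1.2) b else 0)
      = faceAvg n M S (y.1 - unitVec M b.1.2, b.1.2) b := by
    rw [Finset.sum_eq_single (y.1 - unitVec M b.1.2)]
    · rw [if_pos (sub_add_cancel _ _).symm]
    · intro y' _ hne
      rw [if_neg]
      intro h; exact hne (by rw [h, add_sub_cancel_right])
    · intro h; exact absurd (mem_univ _) h
  have t2 : ∑ y' : Tor M, (if y' = y.1 then faceAvg n M S (y', b.1.2) b else 0) = faceAvg n M S (y.1, b.1.2) b := by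
    rw [Finset.sum_ite_eq' univ, if_pos (mem_univ _)]
  rw [t1, t2]

/-- **THE STOKES IDENTITY** `∂₁ᴴ·Φ = Q′_Ω·∂_Ωᴴ`: the unit-lattice divergence (on `S`) of the face fluxes is the block sum of the region
divergence. [folklore] -/
theorem grad1R_conjTranspose_mul_faceAvg : (grad₁R M S)ᴴ * faceAvg n M S = QOm n M S * (gradR n M S)ᴴ := by
  ext y b
  rw [grad1R_conjTranspose_mul_faceAvg_apply, QOm_mul_gradR_conjTranspose_apply]
  obtain ⟨⟨z, ν⟩, hb⟩ := b
  simp only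
  rcases edig_succ_eq_or_lt n M ν z with htop | hlt
  · -- top face: the unit step leaves the block
    rw [blockOf_add_unitVec_e_of_eq n M ν z htop]
    have e1 : faceAvg n M S (y.1 - unitVec M ν, ν) ⟨(z, ν), hb⟩ = if blockOf n M z + unitVec M ν = y.1 then faceW d n else 0 := by
      unfold faceAvg
      simp only [htop, and_true, true_and]
      have hiff : (blockOf n M z = y.1 - unitVec M ν) ↔ (blockOf n M z + unitVec M ν = y.1) :=
        ⟨fun h => by rw [h, sub_add_cancel], fun h => by rw [← h, add_sub_cancel_right]⟩
      by_cases hc : blockOf n M z + unitVec M ν = y.1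
      · rw [if_pos hc, if_pos (hiff.mpr hc)]
      · rw [if_neg hc, if_neg (fun h => hc (hiff.mp h))]
    have e2 : faceAvg n M S (y.1, ν) ⟨(z, ν), hb⟩ = if blockOf n M z = y.1 then faceW d n else 0 := by
      unfold faceAvg
      simp only [htop, and_true, true_and]
    rw [e1, e2]
    split_ifs <;> ring
  · -- not a top-face bond: the unit step stays in the block, both sides vanish
    rw [blockOf_add_unitVec_e_of_lt n M ν z hlt, sub_self, mul_zero]
    have hne : ¬ (edig n M ν z + 1 = n) := by omega
    have e1 : faceAvg n M S (y.1 - unitVec M ν, ν) ⟨(z, ν), hb⟩ = 0 := by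
      unfold faceAvg; rw [if_neg]; rintro ⟨-, -, h⟩; exact hne h
    have e2 : faceAvg n M S (y.1, ν) ⟨(z, ν), hb⟩ = 0 := by
      unfold faceAvg; rw [if_neg]; rintro ⟨-, -, h⟩; exact hne h
    rw [e1, e2, sub_self]

/-! ## §3 Orthogonality to the coarse Dirichlet gradients for region-divergence-free fields -/

/-- `∂₁ᴴ(Φ(B)) = Q′_Ω(∂_ΩᴴB)` on `S`. [folklore] -/
theorem grad1R_conjTranspose_mulVec_faceAvg (B : {b // starReg n M S b} → ℂ) :
    (grad₁R M S)ᴴ *ᵥ (faceAvg n M S *ᵥ B) = QOm n M S *ᵥ ((gradR n M S)ᴴ *ᵥ B) := by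
  rw [Matrix.mulVec_mulVec, Matrix.mulVec_mulVec, grad1R_conjTranspose_mul_faceAvg]

/-- **`Φ(B) ⊥ ∂₁g`**: for a REGION-DIVERGENCE-FREE star-bond field (`∂_ΩᴴB = 0`) and every `g : S → ℂ`, `⟨∂₁g, Φ(B)⟩ = 0`. [folklore] -/
theorem faceAvg_orth (B : {b // starReg n M S b} → ℂ) (hB : (gradR n M S)ᴴ *ᵥ B = 0) (g : {y // S y} → ℂ) :
    star (grad₁R M S *ᵥ g) ⬝ᵥ (faceAvg n M S *ᵥ B) = 0 := by
  rw [star_mulVec_dotProduct, grad1R_conjTranspose_mulVec_faceAvg, hB, Matrix.mulVec_zero, dotProduct_zero]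

omit [NeZero n] hM [DecidablePred S] in
/-- `nsq (u − v) = nsq u + nsq v` for `⟨v, u⟩ = 0`. [folklore] -/
theorem nsq_sub_of_orth {ι : Type*} [Fintype ι] (u v : ι → ℂ) (h : star v ⬝ᵥ u = 0) : nsq (u - v) = nsq u + nsq v := by
  have h' : star u ⬝ᵥ v = 0 := by
    rw [← star_star v, Matrix.star_dotProduct_star, h, star_zero]
  have e : ((nsq (u - v) : ℝ) : ℂ) = ((nsq u + nsq v : ℝ) : ℂ) := by
    rw [← star_dotProduct_self, Complex.ofReal_add, ← star_dotProduct_self, ← star_dotProduct_self, star_sub, sub_dotProduct,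
      dotProduct_sub, dotProduct_sub, h, h']
    ring
  exact_mod_cast e

/-- **THE FACE FLUX SURVIVES EVERY COARSE GRADIENT**: `∂_ΩᴴB = 0 ⟹ nsq Φ(B) ≤ nsq (Φ(B) − ∂₁g)` for every `g : S → ℂ`. [folklore] -/
theorem nsq_faceAvg_le_nsq_sub_grad1R (B : {b // starReg n M S b} → ℂ) (hB : (gradR n M S)ᴴ *ᵥ B = 0) (g : {y // S y} → ℂ) :
    nsq (faceAvg n M S *ᵥ B) ≤ nsq (faceAvg n M S *ᵥ B - grad₁R M S *ᵥ g) := by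
  rw [nsq_sub_of_orth _ _ (faceAvg_orth n M S B hB g)]
  have := nsq_nonneg (grad₁R M S *ᵥ g)
  linarith

/-! ## §4 The tent weights of the comparison `√(n^d)·QB ≈ Λ•Φ(B)` (vocabulary for files 2–3) -/

/-- the BOUNDARY TENT WEIGHT `λ_n = (n+1)/(2n)`: on a unit bond with exactly one end in `S`, Bałaban's line average `Q` sees HALF a tent
of the normal component (`Σ_{h<n}(h+1) = n(n+1)/2` of the `n²` line terms), so `QB ≈ λ_n·Φ(B)` there. [folklore] -/
def lamB (n : ℕ) : ℝ := ((n : ℝ) + 1) / (2 * n)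

/-- the TENT WEIGHTS `Λ(y,ν) = 1` if `y, y + e_ν ∈ S` (full tent), `λ_n` otherwise. [folklore] -/
def tentW (i : Tor M × Fin d) : ℝ := if S i.1 ∧ S (i.1 + unitVec M i.2) then 1 else lamB n

omit hM [DecidablePred S] in
/-- `½ < λ_n ≤ 1` (`n ≥ 1`). [folklore] -/
theorem lamB_bounds : 1 / 2 < lamB n ∧ lamB n ≤ 1 := by
  have hn : (1 : ℝ) ≤ n := by exact_mod_cast Nat.one_le_iff_ne_zero.mpr (NeZero.ne n)
  unfold lamB
  constructor
  · rw [div_lt_div_iff₀ (by norm_num) (by positivity)]; linarith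
  · rw [div_le_one (by positivity)]; linarith

omit hM in
/-- **`|1 − Λ| ≤ ½`** pointwise — the factor that must stay below `1` in file 3's absorption, and does. [folklore] -/
theorem abs_one_sub_tentW_le (i : Tor M × Fin d) : |1 - tentW n M S i| ≤ 1 / 2 := by
  have h := lamB_bounds n
  unfold tentW
  split_ifs
  · simp
  · rw [abs_le]; constructor <;> linarith [h.1, h.2]

omit hM in
/-- `0 ≤ Λ ≤ 1`. [folklore] -/
theorem tentW_mem (i : Tor M × Fin d) : 0 ≤ tentW n M S i ∧ tentW n M S i ≤ 1 := by
  have h := lamB_bounds n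
  unfold tentW
  split_ifs
  · exact ⟨zero_le_one, le_rfl⟩
  · exact ⟨by linarith [h.1], h.2⟩

end Summit.QuantumFields.BalabanUV.T4Continuum.RegionFaceFlux

end
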